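import Summits.CriticalPhenomena.PercolationContinuityZ3.Theorems.PercNearOneGluingNoHeavyRsw3InvasionPondClosure
import HarnessLib

/-!
# RSW3 lane (P2, gen 28): INVASION PERCOLATION XXII — THE FRESHNESS STEP: truncated exponential moments of the exterior cluster of a
# past-local event factorise and are dominated by those of a free cluster (CCN Lemma 3.4, probabilistic part)

builds on p205010 (kernel theorem, internal audit signed; external expert review pending) — NOT used in this file.

Cell `prim-rsw3`, prover seat `prim-rsw3-p2` (gen 28), memo `run/shared/lean/prim/rsw3/P2-RSWLITE.md` §35.  Support file
(`--supports stmt-CriticalPhenomena-4575`); no definitions, no named facts, no sorries.  Notation as in file XXI: `P_n = ⋃_{v ∈ I_n} C_y(v)` the pond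
closure, `M_n(y) = badCount … y n` the number of outlets before time `n`; the TRUNCATED VOLUME of a set of vertices of size `s : ℕ∞` is
`T_L(s) = min(s, L)` (written `((min s L).toNat : ℝ)`).

Chayes–Chayes–Newman's Lemma 3.4: below `π_c` the clusters successively swallowed by the invasion have uniformly exponential tails, "since the
(k+1)-st cluster is discovered in the complement of the checked bonds".  Kernel form, without stopping times: for `t ≥ 0`, a truncation level `L`
and any majorant `Φ ≥ 1 + Σ_{m=1}^{L} (e^{tm} − e^{t(m−1)})·q_m` of the truncated exponential moment of a free cluster (`q_m ≥ μ{m ≤ |C_y(v)|}` for all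
vertices `v`), the process
  `Z_n = exp(t·T_L(|P_n|)) · Φ^{−(M_n(y)+1)}`
satisfies `E[Z_{n+1}] ≤ E[Z_n] ≤ … ≤ E[Z_0] ≤ 1`: a non-outlet step changes nothing; an outlet step multiplies `Z` by at most
`Φ^{−1}·exp(t·T_L|C^{ext}|)` where the exterior cluster `C^{ext}` of the new vertex is independent of the past piece `{I_n = S, w_n = w, outlet, M_n = c}`
(gen 26's `labelMeasure_inter_eq_mul`) and has truncated exponential moment `≤ Φ` (layer cake + file XXI's domination).  Since `|P_N| ≥ N + 1`,
Markov's inequality with `L = N + 1` gives **`μ{M_N(y) ≤ k} ≤ Φ^{k+1}·e^{−t(N+1)}`**: few outlets by time `N` force the first `k + 1` swallowed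
clusters to have total volume `≥ N + 1`.

This file (part one of two) contains the truncation arithmetic and THE FRESHNESS STEP; file XXIII (`…Rsw3InvasionSwallowedClusters`) the
supermartingale and the tail bound; file XXIV (`…Rsw3InvasionOutletDensity`) the `ℤ^d` consequences.

* `toNat_min_add_le`, `le_iff_le_toNat_min`, `sum_Icc_exp_sub_exp`, **`exp_mul_truncVol_eq_layerCake`** (`exp(t·T_L(s)) = 1 + Σ_{m=1}^{L}
  (e^{tm} − e^{t(m−1)})·𝟙{m ≤ s}`), `measurable_truncVol`.
* **`integral_indicator_mul_exp_exterior_le`** — `E[𝟙_A · exp(t·T_L|C^{ext,S}_y(w)|)] ≤ μ(A)·(1 + Σ_{m=1}^{L} (e^{tm} − e^{t(m−1)}) q_m)` for every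
  `S`-local event `A` and tail majorants `q_m ≥ μ{m ≤ |C_y(v)|}` (THE FRESHNESS STEP: independence from gen 26's `labelMeasure_inter_eq_mul`,
  domination from file XXI).

References: J. T. Chayes, L. Chayes, C. M. Newman, Comm. Math. Phys. 101 (1985) 383–407, Lemma 3.4 (and (3.18)–(3.21)) [ChayesChayesNewman1985].
-/

noncomputable section

namespace Summit.CriticalPhenomena.PercolationContinuityZ3.Theorems.Rsw3

open Finset MeasureTheory Filter Topology Literature.Probability.Percolation Literature.Probability.Percolation.Invasion
open scoped ENNReal

/-! ## §1 Truncated volumes and the layer-cake form of their exponential -/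

/-- `min` commutes with the coercion `ℕ → ℕ∞`. [folklore] -/
theorem min_coe_coe_enat (x L : ℕ) : min (x : ℕ∞) (L : ℕ∞) = ((min x L : ℕ) : ℕ∞) := by
  rcases le_total x L with h | h
  · rw [min_eq_left h, min_eq_left (by exact_mod_cast h)]
  · rw [min_eq_right h, min_eq_right (by exact_mod_cast h)]

/-- Subadditivity of the truncated volume: `T_L(a + b) ≤ T_L(a) + T_L(b)`. [folklore] -/
theorem toNat_min_add_le (a b : ℕ∞) (L : ℕ) :
    (min (a + b) (L : ℕ∞)).toNat ≤ (min a (L : ℕ∞)).toNat + (min b (L : ℕ∞)).toNat := by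
  induction a using ENat.recTopCoe with
  | top => simp
  | coe a =>
    induction b using ENat.recTopCoe with
    | top => simp
    | coe b =>
      rw [← ENat.coe_add, min_coe_coe_enat, min_coe_coe_enat, min_coe_coe_enat]
      simp only [ENat.toNat_coe]
      omega

/-- For `m ≤ L`: `m ≤ s ↔ m ≤ T_L(s)`. [folklore] -/
theorem le_iff_le_toNat_min (s : ℕ∞) {L m : ℕ} (hm : m ≤ L) : (m : ℕ∞) ≤ s ↔ m ≤ (min s (L : ℕ∞)).toNat := by
  induction s using ENat.recTopCoe with
  | top => simp [hm]
  | coe s =>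
    rw [min_coe_coe_enat, ENat.toNat_coe, ENat.coe_le_coe]
    omega

/-- `T_L(s) = L` when `s ≥ L`. [folklore] -/
theorem toNat_min_eq_of_le (s : ℕ∞) {L : ℕ} (h : (L : ℕ∞) ≤ s) : (min s (L : ℕ∞)).toNat = L := by
  rw [min_eq_right h, ENat.toNat_coe]

/-- `T_L(s) ≤ L`. [folklore] -/
theorem toNat_min_le (s : ℕ∞) (L : ℕ) : (min s (L : ℕ∞)).toNat ≤ L :=
  ENat.toNat_le_of_le_coe (min_le_right _ _)

/-- Monotonicity of the truncated volume. [folklore] -/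
theorem toNat_min_mono {a b : ℕ∞} (h : a ≤ b) (L : ℕ) : (min a (L : ℕ∞)).toNat ≤ (min b (L : ℕ∞)).toNat :=
  ENat.toNat_le_toNat (min_le_min_right _ h) (ne_top_of_le_ne_top (ENat.coe_ne_top L) (min_le_right _ _))

/-- The telescoping sum `Σ_{m=1}^{k} (e^{tm} − e^{t(m−1)}) = e^{tk} − 1`. [folklore] -/
theorem sum_Icc_exp_sub_exp (t : ℝ) (k : ℕ) :
    ∑ m ∈ Icc 1 k, (Real.exp (t * m) - Real.exp (t * (m - 1))) = Real.exp (t * k) - 1 := by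
  induction k with
  | zero => simp
  | succ k ih =>
    rw [Finset.sum_Icc_succ_top (by omega), ih]
    push_cast
    ring_nf

/-- **LAYER CAKE**: `exp(t·T_L(s)) = 1 + Σ_{m=1}^{L} (e^{tm} − e^{t(m−1)})·𝟙{m ≤ s}` for every `s : ℕ∞`. [folklore] -/
theorem exp_mul_truncVol_eq_layerCake (t : ℝ) (L : ℕ) (s : ℕ∞) :
    Real.exp (t * ((min s (L : ℕ∞)).toNat : ℝ))
      = 1 + ∑ m ∈ Icc 1 L, (Real.exp (t * m) - Real.exp (t * (m - 1))) * (if (m : ℕ∞) ≤ s then (1 : ℝ) else 0) := by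
  have hkL : (min s (L : ℕ∞)).toNat ≤ L := toNat_min_le s L
  have hsum : ∑ m ∈ Icc 1 L, (Real.exp (t * m) - Real.exp (t * (m - 1))) * (if (m : ℕ∞) ≤ s then (1 : ℝ) else 0)
      = ∑ m ∈ Icc 1 (min s (L : ℕ∞)).toNat, (Real.exp (t * m) - Real.exp (t * (m - 1))) := by
    rw [← Finset.sum_subset (Finset.Icc_subset_Icc_right hkL) (fun m hm hmk => by
      have hmL := (Finset.mem_Icc.1 hm).2
      have : ¬ (m : ℕ∞) ≤ s := by
        rw [le_iff_le_toNat_min s hmL]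
        intro h; exact hmk (Finset.mem_Icc.2 ⟨(Finset.mem_Icc.1 hm).1, h⟩)
      rw [if_neg this, mul_zero])]
    refine Finset.sum_congr rfl fun m hm => ?_
    have hmk := (Finset.mem_Icc.1 hm).2
    have : (m : ℕ∞) ≤ s := (le_iff_le_toNat_min s (hmk.trans hkL)).2 hmk
    rw [if_pos this, mul_one]
  rw [hsum, sum_Icc_exp_sub_exp]
  ring

/-- The layer-cake coefficients are non-negative for `t ≥ 0`. [folklore] -/
theorem exp_sub_exp_pred_nonneg {t : ℝ} (ht : 0 ≤ t) (m : ℕ) : 0 ≤ Real.exp (t * m) - Real.exp (t * (m - 1)) := by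
  have : t * (m - 1) ≤ t * m := by nlinarith
  linarith [Real.exp_le_exp.2 this]

/-- `1 ≤ exp(t·T_L(s)) ≤ exp(t·L)` for `t ≥ 0`. [folklore] -/
theorem exp_mul_truncVol_le {t : ℝ} (ht : 0 ≤ t) (L : ℕ) (s : ℕ∞) :
    Real.exp (t * ((min s (L : ℕ∞)).toNat : ℝ)) ≤ Real.exp (t * L) := by
  have h : (((min s (L : ℕ∞)).toNat : ℕ) : ℝ) ≤ L := by exact_mod_cast toNat_min_le s L
  exact Real.exp_le_exp.2 (by nlinarith)

/-- **Measurability of a truncated volume** from the measurability of the volume events `{m ≤ s}`. [folklore] -/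
theorem measurable_truncVol {Ω : Type*} [MeasurableSpace Ω] {s : Ω → ℕ∞} (hs : ∀ m : ℕ, MeasurableSet {x | (m : ℕ∞) ≤ s x}) (L : ℕ) :
    Measurable fun x => ((min (s x) (L : ℕ∞)).toNat : ℝ) := by
  -- the `ℕ`-valued truncation is measurable: its super-level sets are volume events or empty
  have hge : ∀ j : ℕ, MeasurableSet {x | j ≤ (min (s x) (L : ℕ∞)).toNat} := by
    intro j
    by_cases hj : j ≤ L
    · have : {x | j ≤ (min (s x) (L : ℕ∞)).toNat} = {x | (j : ℕ∞) ≤ s x} := by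
        ext x; simp only [Set.mem_setOf_eq]; exact (le_iff_le_toNat_min (s x) hj).symm
      rw [this]; exact hs j
    · have : {x | j ≤ (min (s x) (L : ℕ∞)).toNat} = ∅ := by
        ext x; simp only [Set.mem_setOf_eq, Set.mem_empty_iff_false, iff_false, not_le]
        exact lt_of_le_of_lt (toNat_min_le (s x) L) (not_le.1 hj)
      rw [this]; exact MeasurableSet.empty
  have hnat : Measurable fun x => (min (s x) (L : ℕ∞)).toNat := by
    refine measurable_to_countable' fun k => ?_
    have : (fun x => (min (s x) (L : ℕ∞)).toNat) ⁻¹' {k}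
        = {x | k ≤ (min (s x) (L : ℕ∞)).toNat} \ {x | k + 1 ≤ (min (s x) (L : ℕ∞)).toNat} := by
      ext x; simp only [Set.mem_preimage, Set.mem_singleton_iff, Set.mem_sdiff, Set.mem_setOf_eq]; omega
    rw [this]; exact (hge k).diff (hge (k + 1))
  exact measurable_from_nat.comp hnat

/-! ## §2 The freshness step: an `S`-local event against the exterior cluster of `S` -/

section General

variable {V : Type*} [DecidableEq V] {G : SimpleGraph V} [G.LocallyFinite] [Countable V]

omit [DecidableEq V] [G.LocallyFinite] in
/-- **THE FRESHNESS STEP** (CCN Lemma 3.4): for a finite `S`, a vertex `w`, an `S`-LOCAL measurable event `A` (determined by the labels touching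
`S`), `t ≥ 0`, a level `L` and tail majorants `q_m ≥ μ{m ≤ |C_y(v)|}` (all `v`, `1 ≤ m ≤ L`):
`E[𝟙_A · exp(t·T_L|C^{ext,S}_y(w)|)] ≤ μ(A) · (1 + Σ_{m=1}^{L} (e^{tm} − e^{t(m−1)}) q_m)` — the exterior cluster is independent of `A` (gen 26
`labelMeasure_inter_eq_mul`) and dominated by a free cluster (file XXI). [cite: ChayesChayesNewman1985, Lemma 3.4 (proof, (3.20)–(3.21))] -/
theorem integral_indicator_mul_exp_exterior_le (y : ℝ) {t : ℝ} (ht : 0 ≤ t) (L : ℕ) (q : ℕ → ℝ)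
    (hq : ∀ (v : V) (m : ℕ), 1 ≤ m → m ≤ L →
      (labelMeasure V).real {U : Sym2 V → ℝ | (m : ℕ∞) ≤ (openCluster (configOfLabels y U G) v).encard} ≤ q m)
    (S : Finset V) (w : V) {A : Set (Sym2 V → ℝ)} (hA : MeasurableSet A)
    (hAloc : ∀ U U' : Sym2 V → ℝ, (∀ e, (∃ x ∈ S, x ∈ e) → U e = U' e) → (U ∈ A ↔ U' ∈ A)) :
    ∫ U, A.indicator (fun _ => (1 : ℝ)) U
        * Real.exp (t * ((min (openCluster (configOfLabels y U (G.deleteEdges {e | ∃ x ∈ S, x ∈ e})) w).encard (L : ℕ∞)).toNat : ℝ))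
      ∂(labelMeasure V)
      ≤ (labelMeasure V).real A * (1 + ∑ m ∈ Icc 1 L, (Real.exp (t * m) - Real.exp (t * (m - 1))) * q m) := by
  haveI : IsProbabilityMeasure (labelMeasure V) := isProbabilityMeasure_labelMeasure _
  set B : ℕ → Set (Sym2 V → ℝ) := fun m =>
    {U | (m : ℕ∞) ≤ (openCluster (configOfLabels y U (G.deleteEdges {e | ∃ x ∈ S, x ∈ e})) w).encard} with hB
  have hBm : ∀ m, MeasurableSet (B m) := fun m => measurableSet_le_encard_exteriorCluster (G := G) y S w m
  set c : ℕ → ℝ := fun m => Real.exp (t * m) - Real.exp (t * (m - 1)) with hc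
  have hc0 : ∀ m, 0 ≤ c m := fun m => exp_sub_exp_pred_nonneg ht m
  -- pointwise layer cake: `𝟙_A · e^{tT} = 𝟙_A + Σ_m c_m 𝟙_{A ∩ B_m}`
  have hpt : ∀ U : Sym2 V → ℝ, A.indicator (fun _ => (1 : ℝ)) U
        * Real.exp (t * ((min (openCluster (configOfLabels y U (G.deleteEdges {e | ∃ x ∈ S, x ∈ e})) w).encard (L : ℕ∞)).toNat : ℝ))
      = A.indicator (fun _ => (1 : ℝ)) U + ∑ m ∈ Icc 1 L, c m * (A ∩ B m).indicator (fun _ => (1 : ℝ)) U := by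
    intro U
    by_cases hUA : U ∈ A
    · rw [Set.indicator_of_mem hUA, one_mul, exp_mul_truncVol_eq_layerCake]
      congr 1
      refine Finset.sum_congr rfl fun m _ => ?_
      by_cases hUB : U ∈ B m
      · rw [Set.indicator_of_mem (Set.mem_inter hUA hUB), if_pos (by exact hUB)]
      · rw [Set.indicator_of_notMem (fun h => hUB h.2), if_neg (by exact hUB)]
    · rw [Set.indicator_of_notMem hUA, zero_mul, zero_add]
      symm
      exact Finset.sum_eq_zero fun m _ => by rw [Set.indicator_of_notMem (fun h => hUA h.1), mul_zero]
  simp_rw [hpt]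
  have hintA : Integrable (fun U => A.indicator (fun _ => (1 : ℝ)) U) (labelMeasure V) := (integrable_const (1 : ℝ)).indicator hA
  have hintB : ∀ m, Integrable (fun U => c m * (A ∩ B m).indicator (fun _ => (1 : ℝ)) U) (labelMeasure V) :=
    fun m => ((integrable_const (1 : ℝ)).indicator (hA.inter (hBm m))).const_mul (c m)
  rw [integral_add hintA (integrable_finsetSum _ fun m _ => hintB m), integral_finsetSum _ fun m _ => hintB m,
    integral_indicator_const _ hA, smul_eq_mul, mul_one, mul_add, mul_one, Finset.mul_sum]
  gcongr with m hm
  rw [integral_const_mul, integral_indicator_const _ (hA.inter (hBm m)), smul_eq_mul, mul_one]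
  -- independence of `A` (local) and `B m` (exterior), then domination of `B m`
  have hind : (labelMeasure V).real (A ∩ B m) = (labelMeasure V).real A * (labelMeasure V).real (B m) :=
    labelMeasure_real_inter_eq_mul S hA (hBm m) hAloc
      (fun U U' h => le_encard_exteriorCluster_iff_of_agree_off (G := G) y S w m U U' h)
  have hdom : (labelMeasure V).real (B m) ≤ q m := by
    refine le_trans ?_ (hq w m (Finset.mem_Icc.1 hm).1 (Finset.mem_Icc.1 hm).2)
    exact measureReal_mono (setOf_le_encard_exteriorCluster_subset (G := G) y S w m) (measure_ne_top _ _)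
  rw [hind, mul_left_comm]
  exact mul_le_mul_of_nonneg_left (mul_le_mul_of_nonneg_left hdom (hc0 m)) measureReal_nonneg

end General

end Summit.CriticalPhenomena.PercolationContinuityZ3.Theorems.Rsw3

end
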